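import Literature.NumberTheory.Automorphic.MirabolicAveraging
import Literature.NumberTheory.Automorphic.AdelicGroupDataGLnProofs
import Literature.NumberTheory.Automorphic.IdeleClassGroupProofs
import HarnessLib

/-!
# Covering weights for the rational points `Q_d(K)` and `|det|_𝔸 = 1` on compact subgroups

Topic `NumberTheory/Automorphic`; namespace `Literature.NumberTheory.Automorphic`. Two small inputs
of the assembly of the real-point Rankin–Selberg bound:

* `discreteTopology_ratPoints` — the embedded rational points `ratPoints H ≤ GL_n(K) ≤ GL_n(𝔸_K)` of
  any `H ≤ GL_n(K)` are discrete (`gl_isDiscreteRational_holds`: `GL_n(K)` is discrete), hence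
  `exists_isCoveringWeight_ratPoints` — **every `Q_d(K)` admits a measurable covering weight**
  `β_d ≥ 0` with `Σ_{γ ∈ Q_d(K)} β_d(γ x) = 1` (`Literature.MeasureTheory.Group.exists_isCoveringWeight`),
  the weights `β_d` of the tower integrals `I^{(d)} = ∫ ‖Φ_d‖² w β_d` (`WhittakerTowerChain`);
* `ideleNorm_det_eq_one_of_isCompact` — **`|det k|_𝔸 = 1` on every compact subgroup of
  `GL_n(𝔸_K)`** (a continuous homomorphism to `ℝ_{>0}` with bounded image is trivial; the finite
  adelic special case is `ideleNorm_det_ofFinite_eq_one_of_isCompact` of `IdeleNormDetGL`), so that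
  `|det(t k)|_𝔸 = |det t|_𝔸` in the Iwasawa coordinates `g = t k`.

Everything is proved.
-/

noncomputable section

open MeasureTheory Measure NumberField IsDedekindDomain Matrix Set Filter Topology
open scoped MatrixGroups ENNReal NNReal

namespace Literature.NumberTheory.Automorphic

section RatPoints

variable {n : ℕ} {K : Type} [Field K] [NumberField K]

/-- `ratPoints H` lies in the arithmetic subgroup `GL_n(K)` of `GL_n(𝔸_K)`. [folklore] -/
theorem ratPoints_le_arithmeticSubgroup (H : Subgroup (GL (Fin n) K)) :
    ratPoints H ≤ ((AdelicGroupData.gl n K).arithmeticSubgroup : Subgroup (GL (Fin n) (AdeleRing (𝓞 K) K))) := by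
  rintro g ⟨h, -, rfl⟩
  exact ⟨h, rfl⟩

/-- **The embedded rational points of `H ≤ GL_n(K)` are discrete in `GL_n(𝔸_K)`** (`GL_n(K)` is
discrete, `gl_isDiscreteRational_holds`). [folklore] -/
instance discreteTopology_ratPoints (H : Subgroup (GL (Fin n) K)) : DiscreteTopology ↥(ratPoints H) := by
  have hd := gl_isDiscreteRational_holds n K
  exact @DiscreteTopology.of_continuous_injective _ _ _ _ hd
    (Subgroup.inclusion (ratPoints_le_arithmeticSubgroup H))
    (continuous_inclusion (ratPoints_le_arithmeticSubgroup H)) (Subgroup.inclusion_injective _)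

variable [MeasurableSpace (GL (Fin n) (AdeleRing (𝓞 K) K))] [BorelSpace (GL (Fin n) (AdeleRing (𝓞 K) K))]

/-- **Every `H(K)` admits a covering weight**: a measurable `β ≥ 0` on `GL_n(𝔸_K)` with
`Σ_{γ ∈ ratPoints H} β(γ x) = 1` for all `x` (the indicator of a strict fundamental domain of the
discrete subgroup, `exists_isCoveringWeight`). [folklore] -/
theorem exists_isCoveringWeight_ratPoints (H : Subgroup (GL (Fin n) K)) :
    ∃ β : GL (Fin n) (AdeleRing (𝓞 K) K) → ℝ≥0∞,
      Literature.MeasureTheory.Group.IsCoveringWeight ↥(ratPoints H) β := by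
  haveI := secondCountableTopology_generalLinearGroup_adeleRing K (Fin n)
  exact Literature.MeasureTheory.Group.exists_isCoveringWeight (ratPoints H)

/-- A family of covering weights `β_d` for all the groups `Q_d(K)`, `d ∈ ℕ`. [folklore] -/
theorem exists_isCoveringWeight_tail :
    ∃ β : ℕ → GL (Fin n) (AdeleRing (𝓞 K) K) → ℝ≥0∞,
      ∀ d, Literature.MeasureTheory.Group.IsCoveringWeight ↥(ratPoints (tailUnipotent n K d)) (β d) := by
  have h := fun d => exists_isCoveringWeight_ratPoints (n := n) (K := K) (tailUnipotent n K d)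
  choose β hβ using h
  exact ⟨β, hβ⟩

end RatPoints

section Det

variable {n : ℕ} {K : Type} [Field K] [NumberField K]

/-- **`|det k|_𝔸 = 1` on every compact subgroup of `GL_n(𝔸_K)`**: `k ↦ |det k|_𝔸` is a continuous
homomorphism to `ℝ_{>0}` whose image is bounded, and a bounded subgroup of `ℝ_{>0}` is trivial.
[folklore] -/
theorem ideleNorm_det_eq_one_of_isCompact {U₀ : Subgroup (GL (Fin n) (AdeleRing (𝓞 K) K))}
    (hU₀ : IsCompact (U₀ : Set (GL (Fin n) (AdeleRing (𝓞 K) K)))) {u : GL (Fin n) (AdeleRing (𝓞 K) K)}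
    (hu : u ∈ U₀) :
    IdeleClassGroup.ideleNorm K (Matrix.GeneralLinearGroup.det u) = 1 := by
  set φ : GL (Fin n) (AdeleRing (𝓞 K) K) →* ℝ≥0 :=
    (IdeleClassGroup.ideleNorm K).comp Matrix.GeneralLinearGroup.det with hφ
  have hφc : Continuous φ := (continuous_ideleNorm_holds K).comp Matrix.GeneralLinearGroup.continuous_det
  change φ u = 1
  obtain ⟨B, hB⟩ := (hU₀.image hφc).bddAbove
  have hbound : ∀ w ∈ U₀, (φ w : ℝ) ≤ B := fun w hw => by exact_mod_cast hB ⟨w, hw, rfl⟩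
  have hne : ∀ w, φ w ≠ 0 := fun w => ideleNorm_ne_zero _
  have hle : ∀ w ∈ U₀, (φ w : ℝ) ≤ 1 := by
    intro w hw
    by_contra hlt
    rw [not_le] at hlt
    obtain ⟨k, hk⟩ := pow_unbounded_of_one_lt (B : ℝ) hlt
    have := hbound (w ^ k) (U₀.pow_mem hw k)
    rw [map_pow, NNReal.coe_pow] at this
    exact absurd (hk.trans_le this) (lt_irrefl _)
  have hinv : (φ u⁻¹ : ℝ) = (φ u : ℝ)⁻¹ := by
    have h1 : φ u⁻¹ * φ u = 1 := by rw [← map_mul, inv_mul_cancel, map_one]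
    exact_mod_cast eq_inv_of_mul_eq_one_left h1
  have h1 := hle u hu
  have h2 := hle u⁻¹ (U₀.inv_mem hu)
  rw [hinv] at h2
  have hpos : (0 : ℝ) < φ u := NNReal.coe_pos.2 (pos_iff_ne_zero.2 (hne u))
  have h3 : (1 : ℝ) ≤ φ u := by rwa [inv_le_one₀ hpos] at h2
  exact_mod_cast le_antisymm h1 h3

/-- In particular `|det (t k)|_𝔸 = |det t|_𝔸` for `k` in a compact subgroup. [folklore] -/
theorem ideleNorm_det_mul_eq_of_isCompact {U₀ : Subgroup (GL (Fin n) (AdeleRing (𝓞 K) K))}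
    (hU₀ : IsCompact (U₀ : Set (GL (Fin n) (AdeleRing (𝓞 K) K)))) (t : GL (Fin n) (AdeleRing (𝓞 K) K))
    {k : GL (Fin n) (AdeleRing (𝓞 K) K)} (hk : k ∈ U₀) :
    IdeleClassGroup.ideleNorm K (Matrix.GeneralLinearGroup.det (t * k)) =
      IdeleClassGroup.ideleNorm K (Matrix.GeneralLinearGroup.det t) := by
  rw [map_mul, map_mul, ideleNorm_det_eq_one_of_isCompact hU₀ hk, mul_one]

end Det

end Literature.NumberTheory.Automorphic
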